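import Literature.MathematicalPhysics.QuantumManyBody.BoseEinsteinCondensation
import Mathlib.MeasureTheory.Measure.Lebesgue.Basic
import HarnessLib

/-!
# The periodic `N`-body Bose gas and the scattering length

Topic `Literature/MathematicalPhysics/QuantumManyBody` (definition item `defn-PeriodicBoseGas`,
companion of `Literature.BoseGas` in `BoseEinsteinCondensation.lean`; wanted by
stmt-AtomisticToContinuum-0691/0733/0734 and route BECRenormGroup crux 0695).

Three layers, all real definitions over `ℝ≥0∞`-valued lower Lebesgue integrals, in the units
`ħ = 2m = 1` (`μ = 1`) of `Literature.BoseGas`: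

1. **Scattering length** `scatteringLength v ∈ [0, ∞]` of a repulsive radial pair-potential
   profile `v : ℝ → ℝ≥0∞` (hard cores `v = ⊤` allowed), by the Lieb–Yngvason variational
   principle [LSSY2005, App. C, Thm. C.1, (C.4), (C.7)–(C.8) with `n = 3`, `μ = 1`]:
   `4π a = inf { ∫_{ℝ³} |∇φ|² + ½ v(|x|) |φ|² dx : φ → 1 at infinity }`.
   Indeed, by (C.8) the minimum of `E_R[φ] = ∫_{B_R} |∇φ|² + ½ v|φ|²` over `φ = 1` on `S_R` is
   `4πa/(1 - a/R)` (`R > R₀ =` range), which decreases to `4πa` as `R → ∞`, and a function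
   equal to `1` off `B_R` has whole-space energy `E_R` (as `v = 0` beyond `R₀`). Equivalently
   `a = lim_{r→∞} (r - u₀(r)/u₀'(r))` for the zero-energy s-wave solution of
   `-2u₀'' + v u₀ = 0` [LSSY2005, (2.3)–(2.6)], and `a = (8π)⁻¹ ∫ v(1-ω)` for the scattering
   solution `(-Δ + ½v)(1-ω) = 0` [Fournais2020, (A.1)–(A.5)]; the factor `½` (i.e. `2μ` in
   (2.3)) is the reduced mass of the two-body problem.
2. **Periodic box.** `cell L = [0,L)³`, `cellN N L = [0,L)^{3N}` (fundamental cell of the torus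
   `(ℝ/Lℤ)^{3N}`), lattice vectors `latticeVec L n = L·n`, the periodised pair potential
   `periodizedPotential v L x = ∑_{n ∈ ℤ³} v(|x - Ln|)` [Fournais2020, (1.1):
   `v^per = ∑_{j∈ℤ³} v(x - Lj)`], `PeriodicTrialState N L` (`C¹`, `Lℤ³`-periodic in every
   particle, Bose-symmetric, normalised on the cell), `periodicEnergy v Ψ = ∫_cell |∇Ψ|² +
   ∑_{i<j} v^per(xᵢ-xⱼ)|Ψ|²` (quadratic form of `H = ∑ⱼ -Δⱼ^per + ∑_{j<k} v^per(xⱼ-x_k)`,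
   [Fournais2020, (1.1)]), `periodicGroundStateEnergy v N L = inf_Ψ` [Fournais2020, (1.2)].
3. **Occupations on the cell.** `cellOccupation N L φ Ψ = ⟨φ, γ_Ψ φ⟩` for a one-body mode `φ` on
   the cell (reusing `Literature.MathematicalPhysics.QuantumManyBody.BoseGas.occupation` with cell indicators), `constantMode L =
   L^{-3/2} 1_cell`, and `condensateOccupation N L Ψ = ⟨Ψ, n₀ Ψ⟩ = N ⟨Ψ, P_Ω,1 Ψ⟩`, the expected
   number of particles in the constant function [Fournais2020, (1.3)–(1.5)].

Named literature facts (`def … : Prop`, hypotheses bound inside, to be consumed as `(h : X)`):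

* `Fournais2020_condensation` — [Fournais2020, Thm. 1.2]: BEC in the constant mode on periodic
  boxes of side `L = C_L (ρa³)^{-δ} (ρa)^{-1/2}` for states with energy
  `≤ 4πaρN + C₀ aρ(ρa³)^{1/2-ε} N`.
* `LSSY2005_lowerBound_periodic`, `LSSY2005_lowerBound_dirichlet` — [LSSY2005, Thm. 2.4 (2.35)]:
  `E₀(N,L)/N ≥ 4πρa(1 - C Y^{1/17})`, `Y = 4πρa³/3 < δ`, `L/a > C' Y^{-6/17}`.
* `LSSY2005_upperBound_periodic` — [LSSY2005, Thm. 2.2 (2.14)]: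
  `E₀^per(N,L)/N ≤ 4πρ₁a(1 + C a/b)`, `ρ₁ = (N-1)/L³`, `b = (4πρ₁/3)^{-1/3}`.

## Design choices

* **Trial classes are `C¹`** (as `Literature.MathematicalPhysics.QuantumManyBody.BoseGas.TrialState`), not `H¹`: for the scattering
  functional the `C¹` functions equal to `1` near infinity are a dense subclass of LSSY's
  `H¹` class (for the potentials at stake: `L¹`, hard core, finite measures) on which the
  functional is continuous, so the *infimum* is LSSY's `4πa` although for a hard core it is not
  attained in `C¹` (the minimiser `(1 - a/|x|)₊` is only Lipschitz). Where `v(|x|) = ⊤` a trial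
  function must vanish (`⊤ · 0 = 0`, `⊤ · c = ⊤` for `c > 0` in `ℝ≥0∞`), which is exactly the
  hard-core condition.
* `|∇φ|²` is the sum of squared partial derivatives (`gradSq`, as `kineticDensity`).
* **Periodicity** of `Ψ` is stated on generators: `Ψ(X + L e_{i,k}) = Ψ(X)` for every particle
  `i` and axis `k` (`Pi.single i (EuclideanSpace.single k L)`).
* **Periodised potential as a lattice sum** (Fournais) rather than `v(dist_torus)`: the `ℝ≥0∞`
  sum always converges; for finite range `R₀ < L/2` at most the nearest-image term is non-zero,
  so it equals `v` of the flat-torus distance (LSSY's "taking the periodic boundary into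
  account", proof of Thm. 2.2). Always `v(|x|) ≤ v^per(x)` (`le_periodizedPotential`), whence
  `interaction v X ≤ periodicInteraction v L X`: the key inequality behind
  "Neumann ≤ periodic" for `v ≥ 0`.
* **Boundary conditions of the LSSY facts.** Thm. 2.4 is printed for *Neumann* conditions,
  which give the lowest energy [LSSY2005, Ch. 2, after (2.2)]: a periodic (resp. Dirichlet)
  trial state restricted to the cell (resp. box) is a Neumann trial state with the same kinetic
  term and, since `v ≥ 0` and `v ≤ v^per`, no smaller interaction; hence (2.35) for Neumann
  implies the two vendored forms, which are formal corollaries (weaker than the source).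
  Thm. 2.2 is printed for periodic conditions with the nearest-image convention; we add the
  hypothesis `2R₀ < L` under which it is our `v^per`, and a smallness threshold on `a/b`
  (the source's "const." is for bounded `a/b`, proof after (2.33)). Fournais's Thm. 1.2 is on
  the torus `ℝ³/Lℤ³` with `v^per` verbatim; his `Ω = (-L/2,L/2)³` and our `[0,L)³` are both
  fundamental cells. All facts quantify `∃ C …` *after* `v` and the parameters (constants may
  depend on them: the weakest reading), take `a := (scatteringLength v).toReal` under the
  explicit hypothesis `scatteringLength v ≠ ⊤` (true for finite range, LSSY App. C Remark 2:
  `a ≤ R₀`; not proved here), and Fournais's Assumption 1.1 (`v ≠ 0`, `L¹`, compact support)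
  is rendered as finite range + `∫ v(|x|)dx < ∞` + `0 < a` (`a > 0` is his stated consequence
  of `v ≠ 0`; conversely `a > 0 ⇒ v ≠ 0` by `four_pi_mul_scatteringLength_le`).
* `ℝ≥0∞` throughout; `PeriodicTrialState N L` is empty for `L ≤ 0` (`cell L = ∅`); then all
  energies are `⊤` and the facts are guarded by `0 < L`.
* Mathlib has no scattering length, periodic Schrödinger operators or Bose gas (searched
  `scattering`, `Bose`, `periodi.*Laplacian`); `EuclideanSpace`, `fderiv`, `lintegral`, `tsum`,
  `Set.indicator`, `PiLp.volume_preserving_ofLp`, `Real.volume_pi_Ico` are Mathlib's.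

## References

* [LSSY2005] E. H. Lieb, R. Seiringer, J. P. Solovej, J. Yngvason, *The Mathematics of the Bose
  Gas and its Condensation*, Birkhäuser 2005 (arXiv:cond-mat/0610117): (2.1)–(2.6) (Hamiltonian,
  scattering length), Thm. 2.2 (2.14) p. 14, Thm. 2.4 (2.35) p. 18, App. C Thm. C.1 (C.4)–(C.8),
  Lemma C.2, (C.10).
* [Fournais2020] S. Fournais, *Length scales for BEC in the dilute Bose gas*, arXiv:2011.00309
  (in: Partial Differential Equations, Spectral Theory, and Mathematical Physics, EMS 2021):
  (1.1)–(1.9), Assumption 1.1, Thm. 1.2, App. A (A.1)–(A.5).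
* [FournaisSolovej2020] S. Fournais, J. P. Solovej, *The energy of dilute Bose gases*, Ann. of
  Math. 192 (2020) (arXiv:1904.06164) — the Lee–Huang–Yang lower bound (not vendored here: it
  concerns the thermodynamic-limit energy density).
-/

noncomputable section

open MeasureTheory Filter Metric WithLp
open scoped ENNReal NNReal ComplexConjugate

namespace Literature.MathematicalPhysics.QuantumManyBody.BoseGas

/-! ### The scattering length -/

/-- `|∇φ(x)|² = ∑ₖ |∂ₖφ(x)|²` for a real function on `ℝ³` (squared Fréchet derivative along the
coordinate axes; `0` where `φ` is not differentiable, by `fderiv`'s convention). [cite: LSSY2005, App. C (C.4)] -/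
def gradSq (φ : Space → ℝ) (x : Space) : ℝ≥0∞ :=
  ∑ k : Fin 3, (‖fderiv ℝ φ x (EuclideanSpace.single k (1 : ℝ))‖₊ : ℝ≥0∞) ^ 2

/-- The **scattering functional** `𝓔[φ] = ∫_{ℝ³} (|∇φ|² + ½ v(|x|) |φ(x)|²) dx ∈ [0, ∞]` of a radial
pair-potential profile `v` (units `ħ = 2m = 1`, so LSSY's `μ = 1`; the `½` is the reduced mass of
the two-body problem, cf. `-2μΔψ + vψ = 0`). This is `E_R[φ]` of LSSY (C.4) on all of `ℝ³`.
[cite: LSSY2005, App. C (C.4) and (2.3)] -/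
def scatteringFunctional (v : ℝ → ℝ≥0∞) (φ : Space → ℝ) : ℝ≥0∞ :=
  ∫⁻ x, gradSq φ x + 2⁻¹ * v ‖x‖ * (‖φ x‖₊ : ℝ≥0∞) ^ 2

/-- Admissible trial functions for the scattering length: `φ : ℝ³ → ℝ` of class `C¹`, equal to
`1` outside a compact set (`1 - φ` compactly supported), i.e. `φ = 1` on and beyond some sphere
`S_R` — LSSY's boundary condition `φ = 1` on `S_R`, extended by `1`. [cite: LSSY2005, App. C Thm. C.1] -/
def IsScatteringTrial (φ : Space → ℝ) : Prop :=
  ContDiff ℝ 1 φ ∧ HasCompactSupport (fun x => 1 - φ x)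

/-- The **scattering length** `a ∈ [0, ∞]` of a repulsive radial pair potential `v : ℝ → ℝ≥0∞`
(three dimensions), by the Lieb–Yngvason variational principle:
`4π a = inf { ∫ |∇φ|² + ½ v(|x|)|φ|² : φ ∈ C¹, φ = 1 near infinity }`
(LSSY Thm. C.1 with `n = 3`, `μ = 1`: the minimum of `E_R` under `φ|_{S_R} = 1` is
`4πa/(1 - a/R)` by (C.8), decreasing to `4πa` as `R → ∞`). For the hard core of radius `a`
(`v = ⊤` on `[0,a]`) this is `a`; for `v = 0` it is `0` (`scatteringLength_zero`); `v ≤ w`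
gives `a(v) ≤ a(w)` (`scatteringLength_mono`, LSSY Lemma C.2 (C)); and
`4πa ≤ ½ ∫ v(|x|) dx` (`four_pi_mul_scatteringLength_le`, Spruch–Rosenberg, LSSY (C.10)).
Equivalently `a = lim_{r → ∞} (r - u₀(r)/u₀'(r))` for the zero-energy radial solution
[LSSY (2.5)] and `a = (8π)⁻¹ ∫ v(1 - ω)` [Fournais 2020, (A.5)]. [cite: LSSY2005, App. C Thm. C.1 (C.4)–(C.8)] -/
def scatteringLength (v : ℝ → ℝ≥0∞) : ℝ≥0∞ :=
  (ENNReal.ofReal (4 * Real.pi))⁻¹ *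
    ⨅ (φ : Space → ℝ) (_ : IsScatteringTrial φ), scatteringFunctional v φ

/-- The constant function `1` is an admissible scattering trial function. [cite: LSSY2005, App. C, proof of (C.9)–(C.10)] -/
theorem isScatteringTrial_one : IsScatteringTrial fun _ => (1 : ℝ) :=
  ⟨contDiff_const, by
    simp only [sub_self]
    exact HasCompactSupport.zero⟩

/-- Variational principle: every admissible `φ` bounds `4πa` from above,
`a ≤ (4π)⁻¹ 𝓔[φ]`. [cite: LSSY2005, App. C Thm. C.1] -/
theorem scatteringLength_le {v : ℝ → ℝ≥0∞} {φ : Space → ℝ} (hφ : IsScatteringTrial φ) :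
    scatteringLength v ≤ (ENNReal.ofReal (4 * Real.pi))⁻¹ * scatteringFunctional v φ :=
  mul_le_mul_right (iInf₂_le φ hφ) _

/-- Monotonicity of the scattering length in the potential: `v ≤ w ⇒ a(v) ≤ a(w)`
(LSSY Lemma C.2 (C); here immediate from the variational definition). [cite: LSSY2005, App. C Lemma C.2 (C)] -/
theorem scatteringLength_mono {v w : ℝ → ℝ≥0∞} (h : ∀ r, v r ≤ w r) :
    scatteringLength v ≤ scatteringLength w := by
  refine mul_le_mul_right (iInf₂_mono fun φ _ => lintegral_mono fun x => ?_) _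
  gcongr
  exact h _

/-- **Spruch–Rosenberg inequality** `4π a ≤ ½ ∫_{ℝ³} v(|x|) dx`, from the trial function
`φ ≡ 1` (LSSY (C.10) with `n = 3`, `μ = 1`, in the limit `R → ∞`). [cite: LSSY2005, App. C (C.10)] -/
theorem four_pi_mul_scatteringLength_le (v : ℝ → ℝ≥0∞) :
    ENNReal.ofReal (4 * Real.pi) * scatteringLength v ≤ ∫⁻ x : Space, 2⁻¹ * v ‖x‖ := by
  have h4 : ENNReal.ofReal (4 * Real.pi) ≠ 0 := by
    rw [ENNReal.ofReal_ne_zero_iff]; positivity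
  calc ENNReal.ofReal (4 * Real.pi) * scatteringLength v
      ≤ ENNReal.ofReal (4 * Real.pi) *
          ((ENNReal.ofReal (4 * Real.pi))⁻¹ * scatteringFunctional v fun _ => 1) :=
        mul_le_mul_right (scatteringLength_le isScatteringTrial_one) _
    _ = scatteringFunctional v fun _ => 1 := by
        rw [← mul_assoc, ENNReal.mul_inv_cancel h4 ENNReal.ofReal_ne_top, one_mul]
    _ = ∫⁻ x : Space, 2⁻¹ * v ‖x‖ := by
        refine lintegral_congr fun x => ?_
        simp [gradSq]

/-- An integrable potential (`∫ ½ v(|x|) dx < ∞`, e.g. Fournais's Assumption 1.1) has finite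
scattering length. [cite: LSSY2005, App. C (C.10)] -/
theorem scatteringLength_ne_top {v : ℝ → ℝ≥0∞} (hv : (∫⁻ x : Space, 2⁻¹ * v ‖x‖) ≠ ⊤) :
    scatteringLength v ≠ ⊤ := by
  have h := four_pi_mul_scatteringLength_le v
  intro htop
  rw [htop, ENNReal.mul_top (by rw [ENNReal.ofReal_ne_zero_iff]; positivity)] at h
  exact hv (top_le_iff.mp h)

/-- The free gas has scattering length `0`. [cite: LSSY2005, App. C (C.10)] -/
theorem scatteringLength_zero : scatteringLength 0 = 0 := by
  have h := four_pi_mul_scatteringLength_le 0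
  simp only [Pi.zero_apply, mul_zero, lintegral_const, zero_mul, nonpos_iff_eq_zero,
    mul_eq_zero, ENNReal.ofReal_eq_zero] at h
  exact h.resolve_left (not_le.mpr (by positivity))

/-! ### The periodic box -/

/-- The fundamental cell `[0, L)³ ⊂ ℝ³` of the torus `ℝ³/Lℤ³`. [cite: Fournais2020, (1.1) (Ω identified with ℝ³/Lℤ³)] -/
def cell (L : ℝ) : Set Space :=
  {x | ∀ k, x k ∈ Set.Ico 0 L}

/-- The `N`-particle fundamental cell `[0, L)^{3N}`. [cite: Fournais2020, (1.1)] -/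
def cellN (N : ℕ) (L : ℝ) : Set (Config N) :=
  {X | ∀ i, X i ∈ cell L}

/-- The lattice vector `L·n ∈ Lℤ³ ⊂ ℝ³` of `n ∈ ℤ³`. [cite: Fournais2020, (1.1)] -/
def latticeVec (L : ℝ) (n : Fin 3 → ℤ) : Space :=
  toLp 2 fun k => L * (n k : ℝ)

/-- The **periodised pair potential** `v^per(x) = ∑_{n ∈ ℤ³} v(|x - L n|) ∈ [0, ∞]` of a radial
profile `v` on the torus of side `L` (an unconditional sum in `ℝ≥0∞`; for finite range
`R₀ < L/2` only the nearest image contributes). [cite: Fournais2020, (1.1)] -/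
def periodizedPotential (v : ℝ → ℝ≥0∞) (L : ℝ) (x : Space) : ℝ≥0∞ :=
  ∑' n : Fin 3 → ℤ, v ‖x - latticeVec L n‖

/-- The periodic interaction `∑_{i<j} v^per(xᵢ - xⱼ)` of a configuration. [cite: Fournais2020, (1.1)] -/
def periodicInteraction {N : ℕ} (v : ℝ → ℝ≥0∞) (L : ℝ) (X : Config N) : ℝ≥0∞ :=
  ∑ i : Fin N, ∑ j : Fin N with i < j, periodizedPotential v L (X i - X j)

/-- Admissible (bosonic, **periodic**) trial wave functions for `N` particles on the torus
`(ℝ³/Lℤ³)`: `Ψ : (ℝ³)^N → ℂ` of class `C¹`, `Lℤ³`-periodic in every particle coordinate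
(stated on the generators `L e_{i,k}`), symmetric under permutations of the particles, and
normalised on the fundamental cell `[0,L)^{3N}`. These restrict to a form core of
`H = ∑ⱼ -Δⱼ^per + ∑_{j<k} v^per(xⱼ - x_k)` on `⊗ˢᴺ L²(Ω)`. Empty for `L ≤ 0`. [cite: Fournais2020, (1.1)–(1.2)] -/
structure PeriodicTrialState (N : ℕ) (L : ℝ) where
  /-- The wave function `Ψ(x₁, …, x_N)` on `(ℝ³)^N`. -/
  ψ : Config N → ℂ
  /-- `Ψ` is `C¹`. -/
  contDiff : ContDiff ℝ 1 ψ
  /-- Periodicity: `Ψ(…, xᵢ + L e_k, …) = Ψ(…, xᵢ, …)` for every particle `i` and axis `k`. -/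
  periodic : ∀ (X : Config N) (i : Fin N) (k : Fin 3),
    ψ (X + Pi.single i (EuclideanSpace.single k L)) = ψ X
  /-- Bose symmetry. -/
  symm : ∀ (σ : Equiv.Perm (Fin N)) (X : Config N), ψ (X ∘ σ) = ψ X
  /-- Normalisation on the fundamental cell: `∫_{[0,L)^{3N}} |Ψ|² = 1`. -/
  norm_eq : ∫⁻ X in cellN N L, (‖ψ X‖₊ : ℝ≥0∞) ^ 2 = 1

/-- The periodic energy `⟨Ψ, H Ψ⟩ = ∫_{[0,L)^{3N}} (|∇Ψ|² + ∑_{i<j} v^per(xᵢ - xⱼ)|Ψ|²) dX` of a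
periodic trial state (quadratic form of Fournais's `H(N, L)`, units `ħ = 2m = 1`). [cite: Fournais2020, (1.1)] -/
def periodicEnergy {N : ℕ} {L : ℝ} (v : ℝ → ℝ≥0∞) (Ψ : PeriodicTrialState N L) : ℝ≥0∞ :=
  ∫⁻ X in cellN N L, kineticDensity Ψ.ψ X + periodicInteraction v L X * (‖Ψ.ψ X‖₊ : ℝ≥0∞) ^ 2

/-- The periodic ground-state energy `E(N, L) = inf Spec H(N, L) = inf_Ψ ⟨Ψ, HΨ⟩` (infimum of
the quadratic form over the periodic `C¹` core; `⊤` if `L ≤ 0`). [cite: Fournais2020, (1.2)] -/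
def periodicGroundStateEnergy (v : ℝ → ℝ≥0∞) (N : ℕ) (L : ℝ) : ℝ≥0∞ :=
  ⨅ Ψ : PeriodicTrialState N L, periodicEnergy v Ψ

/-! ### Occupations on the cell -/

/-- The normalised **constant mode** `φ₀ = L^{-3/2} 1_{[0,L)³}` of the periodic box (range of
Fournais's projection `P_Ω = L⁻³ |1⟩⟨1|`). [cite: Fournais2020, (1.3)] -/
def constantMode (L : ℝ) : Space → ℂ :=
  (cell L).indicator fun _ => ((Real.sqrt (L ^ 3))⁻¹ : ℂ)

/-- The occupation `⟨φ, γ_Ψ φ⟩` of a one-body mode `φ` *of the cell* in a periodic `N`-body wave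
function `Ψ`: `Literature.MathematicalPhysics.QuantumManyBody.BoseGas.occupation` applied to `φ 1_cell` and `Ψ 1_{cell^N}` (all integrals
restricted to the fundamental cell). [cite: LSSY2005, §1.2 (1.17)] -/
def cellOccupation (N : ℕ) (L : ℝ) (φ : Space → ℂ) (Ψ : Config N → ℂ) : ℝ≥0∞ :=
  occupation N ((cell L).indicator φ) ((cellN N L).indicator Ψ)

/-- The expected number of condensed particles `⟨Ψ, n₀ Ψ⟩ = N ⟨Ψ, P_{Ω,1} Ψ⟩ =
N ∫_{cell^{N-1}} |∫_cell L^{-3/2} Ψ(x, X) dx|² dX` (Fournais's `n₀ = ∑ⱼ P_{Ω,j}`, by Bose symmetry);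
`⟨Ψ, n₊ Ψ⟩ = N - ⟨Ψ, n₀ Ψ⟩`. [cite: Fournais2020, (1.3)–(1.5)] -/
def condensateOccupation (N : ℕ) (L : ℝ) (Ψ : Config N → ℂ) : ℝ≥0∞ :=
  occupation N (constantMode L) ((cellN N L).indicator Ψ)

/-! ### Named literature facts -/

/-- **Fournais 2020, Theorem 1.2** (BEC on length scales beyond Gross–Pitaevskii). Suppose `v`
satisfies Assumption 1.1 (`v ≠ 0` non-negative, radial, `L¹(ℝ³)` with compact support; then
`0 < a < ∞`). Fix `C_L > 0`, `δ > 0` and tie the box to the density `ρ = N/L³` by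
`L = C_L (ρa³)^{-δ} (ρa)^{-1/2}` (1.7). Let `ε ∈ [0, ½]` and `C₀ > 0`. If `Ψ ∈ ⊗ˢᴺ L²(Ω)` is
normalised with `⟨Ψ, HΨ⟩ ≤ 4πaρN + C₀ aρ (ρa³)^{1/2-ε} N` (1.8), then
`⟨Ψ, n₊Ψ⟩ / N ≤ C ρ a L² (ρa³)^{1/2-ε}` (1.9); in particular complete condensation if
`2δ + ε < ½`. Vendored in the regime `ρa³ ≤ c` of the paper ("we study the limit `ρa³ → 0`"),
for periodic `C¹` states, with `⟨Ψ, n₊Ψ⟩ = N - ⟨Ψ, n₀Ψ⟩` written additively, and with `C, c`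
allowed to depend on `v, C_L, δ, ε, C₀`. [cite: Fournais2020, Thm. 1.2] -/
def Fournais2020_condensation : Prop :=
  ∀ (v : ℝ → ℝ≥0∞), IsRepulsiveFiniteRange v → (∫⁻ x : Space, v ‖x‖) ≠ ⊤ →
    0 < scatteringLength v →
  ∀ (C_L δ ε C₀ : ℝ), 0 < C_L → 0 < δ → 0 ≤ ε → ε ≤ 1 / 2 → 0 < C₀ →
  ∃ C c : ℝ, 0 < C ∧ 0 < c ∧
    ∀ (N : ℕ) (L : ℝ), 0 < N → 0 < L →
      let a := (scatteringLength v).toReal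
      let ρ := (N : ℝ) / L ^ 3
      ρ * a ^ 3 ≤ c →
      L = C_L * (ρ * a ^ 3) ^ (-δ) / Real.sqrt (ρ * a) →
      ∀ Ψ : PeriodicTrialState N L,
        periodicEnergy v Ψ ≤ ENNReal.ofReal
            (4 * Real.pi * a * ρ * N + C₀ * a * ρ * (ρ * a ^ 3) ^ (1 / 2 - ε) * N) →
        (N : ℝ≥0∞) ≤ condensateOccupation N L Ψ.ψ +
            ENNReal.ofReal (C * ρ * a * L ^ 2 * (ρ * a ^ 3) ^ (1 / 2 - ε) * N)

/-- **LSSY Theorem 2.4** (lower bound in a finite box), periodic form. For a positive potential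
`v` of finite range there is `δ > 0` such that the ground-state energy of (2.1) with *Neumann*
boundary conditions satisfies `E₀(N,L)/N ≥ 4πμρa (1 - C Y^{1/17})` (2.35) for all `N, L` with
`Y = 4πρa³/3 < δ` and `L/a > C' Y^{-6/17}`, `C, C'` independent of `N, L`. Since Neumann
conditions give the lowest energy and `v ≤ v^per` (`le_periodizedPotential`), the same bound
holds for the periodic ground-state energy `periodicGroundStateEnergy` (formal corollary; units
`μ = 1`; `a := (scatteringLength v).toReal`, finite by App. C Remark 2). [cite: LSSY2005, Thm. 2.4 (2.35)] -/
def LSSY2005_lowerBound_periodic : Prop :=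
  ∀ (v : ℝ → ℝ≥0∞), IsRepulsiveFiniteRange v → scatteringLength v ≠ ⊤ →
  ∃ δ C C' : ℝ, 0 < δ ∧ 0 < C ∧ 0 < C' ∧
    ∀ (N : ℕ) (L : ℝ), 0 < L →
      let a := (scatteringLength v).toReal
      let ρ := (N : ℝ) / L ^ 3
      let Y := 4 * Real.pi * ρ * a ^ 3 / 3
      Y < δ → C' * Y ^ (-(6 : ℝ) / 17) < L / a →
      ENNReal.ofReal (4 * Real.pi * ρ * a * (1 - C * Y ^ ((1 : ℝ) / 17)) * N) ≤
        periodicGroundStateEnergy v N L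

/-- **LSSY Theorem 2.4** (lower bound in a finite box), Dirichlet form: as
`LSSY2005_lowerBound_periodic`, for the Dirichlet ground-state energy
`Literature.BoseGas.groundStateEnergy v N L` on `Λ_L = (0,L)³` (Dirichlet trial states are Neumann
trial states, so the printed Neumann bound (2.35) implies this one). [cite: LSSY2005, Thm. 2.4 (2.35)] -/
def LSSY2005_lowerBound_dirichlet : Prop :=
  ∀ (v : ℝ → ℝ≥0∞), IsRepulsiveFiniteRange v → scatteringLength v ≠ ⊤ →
  ∃ δ C C' : ℝ, 0 < δ ∧ 0 < C ∧ 0 < C' ∧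
    ∀ (N : ℕ) (L : ℝ), 0 < L →
      let a := (scatteringLength v).toReal
      let ρ := (N : ℝ) / L ^ 3
      let Y := 4 * Real.pi * ρ * a ^ 3 / 3
      Y < δ → C' * Y ^ (-(6 : ℝ) / 17) < L / a →
      ENNReal.ofReal (4 * Real.pi * ρ * a * (1 - C * Y ^ ((1 : ℝ) / 17)) * N) ≤
        groundStateEnergy v N L

/-- **LSSY Theorem 2.2** (Dyson–Lieb–Seiringer–Yngvason upper bound). Let `ρ₁ = (N-1)/L³` and
`b = (4πρ₁/3)^{-1/3}`. For non-negative `v` and `b > a` the ground-state energy of (2.1) with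
periodic boundary conditions satisfies `E₀(N,L)/N ≤ 4πμρ₁a (1 + const·a/b)` (2.14) (the constant
is for bounded `a/b`, proof after (2.33)). Vendored for finite-range `v` (range `R₀`) on boxes
with `2R₀ < L`, where LSSY's nearest-image interaction is `v^per`, and for `a/b ≤ c`; units
`μ = 1`, `N ≥ 2` so that `ρ₁ > 0`. [cite: LSSY2005, Thm. 2.2 (2.14)] -/
def LSSY2005_upperBound_periodic : Prop :=
  ∀ (v : ℝ → ℝ≥0∞) (R₀ : ℝ), Measurable v → (∀ r, R₀ < r → v r = 0) →
    scatteringLength v ≠ ⊤ →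
  ∃ C c : ℝ, 0 < C ∧ 0 < c ∧
    ∀ (N : ℕ) (L : ℝ), 2 ≤ N → 0 < L → 2 * R₀ < L →
      let a := (scatteringLength v).toReal
      let ρ₁ := ((N : ℝ) - 1) / L ^ 3
      let b := (4 * Real.pi * ρ₁ / 3) ^ (-(1 : ℝ) / 3)
      a / b ≤ c →
      periodicGroundStateEnergy v N L ≤
        ENNReal.ofReal (4 * Real.pi * ρ₁ * a * (1 + C * (a / b)) * N)

/-! ### Basic API -/

/-- Variational principle for the periodic problem. [cite: Fournais2020, (1.2)] -/
theorem periodicGroundStateEnergy_le {N : ℕ} {L : ℝ} (v : ℝ → ℝ≥0∞)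
    (Ψ : PeriodicTrialState N L) : periodicGroundStateEnergy v N L ≤ periodicEnergy v Ψ :=
  iInf_le _ Ψ

/-- `L · 0 = 0`. [folklore] -/
@[simp]
theorem latticeVec_zero (L : ℝ) : latticeVec L 0 = 0 := by
  ext k; simp [latticeVec]

/-- The periodised potential dominates the potential: `v(|x|) ≤ v^per(x)` (the `n = 0` term of a
sum of non-negative terms). This is why Neumann/Dirichlet energies with `v` are bounded by
periodic energies with `v^per`. [cite: Fournais2020, (1.1)] -/
theorem le_periodizedPotential (v : ℝ → ℝ≥0∞) (L : ℝ) (x : Space) :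
    v ‖x‖ ≤ periodizedPotential v L x := by
  unfold periodizedPotential
  simpa using ENNReal.le_tsum (f := fun n : Fin 3 → ℤ => v ‖x - latticeVec L n‖) 0

/-- `∑_{i<j} v(|xᵢ - xⱼ|) ≤ ∑_{i<j} v^per(xᵢ - xⱼ)`. [cite: Fournais2020, (1.1)] -/
theorem interaction_le_periodicInteraction {N : ℕ} (v : ℝ → ℝ≥0∞) (L : ℝ) (X : Config N) :
    interaction v X ≤ periodicInteraction v L X := by
  refine Finset.sum_le_sum fun i _ => Finset.sum_le_sum fun j _ => ?_
  rw [dist_eq_norm]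
  exact le_periodizedPotential v L _

/-- The cell `[0,L)³` is measurable. [folklore] -/
theorem measurableSet_cell (L : ℝ) : MeasurableSet (cell L) := by
  have : cell L = ⋂ k : Fin 3, (fun x : Space => x k) ⁻¹' Set.Ico 0 L := by
    ext x; simp [cell]
  rw [this]
  exact MeasurableSet.iInter fun k => measurableSet_Ico.preimage (by fun_prop)

/-- `|[0,L)³| = L³` (as `ENNReal.ofReal L ^ 3`; `0` for `L ≤ 0`). [folklore] -/
theorem volume_cell (L : ℝ) : volume (cell L) = ENNReal.ofReal L ^ 3 := by
  have h : cell L = (@ofLp 2 (Fin 3 → ℝ)) ⁻¹' (Set.univ.pi fun _ => Set.Ico 0 L) := by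
    ext x; simp [cell]
  rw [h, (PiLp.volume_preserving_ofLp (Fin 3)).measure_preimage
    (MeasurableSet.univ_pi fun _ => measurableSet_Ico).nullMeasurableSet, volume_pi_pi]
  simp

/-- `|[0,L)^{3N}| = L^{3N}`. [folklore] -/
theorem volume_cellN (N : ℕ) (L : ℝ) : volume (cellN N L) = (ENNReal.ofReal L ^ 3) ^ N := by
  have h : cellN N L = Set.univ.pi fun _ : Fin N => cell L := by
    ext X; simp [cellN]
  rw [h, volume_pi_pi]
  simp [volume_cell]

/-- **Non-vacuity.** For `L > 0`, the one-particle constant state `Ψ ≡ L^{-3/2}` (the constant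
mode extended periodically) is an admissible periodic trial state. [folklore] -/
def PeriodicTrialState.const {L : ℝ} (hL : 0 < L) : PeriodicTrialState 1 L where
  ψ _ := ((Real.sqrt (L ^ 3))⁻¹ : ℂ)
  contDiff := contDiff_const
  periodic _ _ _ := rfl
  symm _ _ := rfl
  norm_eq := by
    have hL3 : 0 < L ^ 3 := by positivity
    have hc : ((‖((Real.sqrt (L ^ 3))⁻¹ : ℂ)‖₊ : ℝ≥0∞) ^ 2) = ENNReal.ofReal ((L ^ 3)⁻¹) := by
      rw [← ENNReal.coe_pow, ENNReal.ofReal, ENNReal.coe_inj]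
      ext
      rw [NNReal.coe_pow, coe_nnnorm, norm_inv, Complex.norm_real,
        Real.norm_of_nonneg (Real.sqrt_nonneg _), inv_pow, Real.sq_sqrt hL3.le,
        Real.coe_toNNReal _ (by positivity)]
    rw [setLIntegral_const, volume_cellN, hc, pow_one, ← ENNReal.ofReal_pow hL.le,
      ← ENNReal.ofReal_mul (by positivity), inv_mul_cancel₀ hL3.ne', ENNReal.ofReal_one]

/-- For `L > 0` the periodic trial states are inhabited, so `periodicGroundStateEnergy v 1 L`
is not an infimum over an empty type. [folklore] -/
theorem PeriodicTrialState.nonempty_one {L : ℝ} (hL : 0 < L) :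
    Nonempty (PeriodicTrialState 1 L) :=
  ⟨PeriodicTrialState.const hL⟩

/-- For one particle on the torus the periodic ground-state energy vanishes (the constant
function has zero kinetic energy and there is no pair interaction). [folklore] -/
theorem periodicGroundStateEnergy_one {L : ℝ} (hL : 0 < L) (v : ℝ → ℝ≥0∞) :
    periodicGroundStateEnergy v 1 L = 0 := by
  refine le_antisymm ((periodicGroundStateEnergy_le v (PeriodicTrialState.const hL)).trans
    (le_of_eq ?_)) bot_le
  refine (lintegral_congr fun X => ?_).trans lintegral_zero
  simp [PeriodicTrialState.const, kineticDensity, periodicInteraction]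

end Literature.MathematicalPhysics.QuantumManyBody.BoseGas

end
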